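import Summits.ValiantsHypothesis.ValiantsHypothesis.Theorems.LacunarySymmetroidMatrixDescartesDoorA26WallBubblingSignedClusterData
import Summits.ValiantsHypothesis.ValiantsHypothesis.Theorems.LacunarySymmetroidMatrixDescartesDoorA26WallBubblingMixedParity

/-!
# `DoorA26` line `wall_bubbling` — KILL(j) IN CENSUS CURRENCY: no accumulation from a KILL side outside the collapse regime

HONEST FRAMING.  Object-search cell `pub-symmetroid`; crux `Theses.LacunarySymmetroid.DoorA26` (stmt-ValiantsHypothesis-19979; OPEN,
typed, never asserted).  Line `Cruxes/DoorA26/Lines/wall_bubbling.lean` (val-idea-15), obligation (M) `Stmt.stub_mixedWalls` (slot W1).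
W1 #1 (`…WallBubblingMixedParity.mixedWall_parity_kill`) is KILL(j) as a theorem about SEQUENCES of realisable-shaped Gram matrices with
(a) the mixed-wall block anatomy `hblock`, (b) opposite signs `G^ν_jj·G^ν_ii < 0`, `G^ν_jk·G^ν_jl ≤ 0`, (c) a non-degenerate cross
direction.  W3 (`…SecondOrderMixedWall.mixedWall_hblock`) supplies (a) from an accumulation of twenties; #10a
(`…SignedClusters`, `…SignedClusterData`) supplies (b) from the CHAMBER: the stage Gram vectors of an accumulation from the open cone of a
pair order `σ` alternate along `σ`.  This file assembles the census-currency statement (def-free):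

* `facet_step_eq`, `honly_of_facet` — at a GENERIC facet point of `σ` (equality at position `t`, strict elsewhere) the only pair-sum
  coincidence is the one between the two pairs listed at `t, t+1` (W3's hypothesis `honly`);
* `mixedWall_kill_collapse` — **KILL(j), CENSUS CURRENCY, MODULO COLLAPSE**: data = positions `t₀, a, b, c` of `σ` listing `(i,i)`,
  `(j,j)`, `{j,k}`, `{j,l}` with the PARITY CERTIFICATE `Odd (a + t₀) ∧ Odd (b + c)` (decidable per facet); for every `σ`-signed,
  stage-realisable cluster datum whose cluster `c` has the mixed block anatomy at scale `B`, every subsequence, every scale `ρ_ν > 0` and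
  every limit `ω` of the rescaled `j`-cross vectors `(ρ ν)⁻¹ · (G_ij, G_kj, G_lj)`: `ω₀ = 0 ∧ ω₁·ω₂ = 0` — the COLLAPSE REGIME of the card
  (the cross vector concentrates on ONE of `(j,k)`, `(j,l)`: `collapse_shape`); `exists_cross_direction` shows such `(φ, ρ, ω)` with
  `‖ω‖ = 1` always exist (non-vacuity);
* `kill_side_of_row` — **«NO ACCUMULATION FROM A KILL SIDE OUTSIDE THE COLLAPSE REGIME»** (R2694 (B) verbatim): at a generic MIXED facet
  point `δ₀` between the chamber of `σ` (carrying the parity certificate for `j`) and the chamber of `σ ∘ swap(t,t+1)` carrying the integer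
  door-A row, every accumulation of twenties at `δ₀` comes from the cone of `σ` and its blow-up datum is `j`-collapsed.

HONEST LIMITS.  Modulo collapse exactly as #1: the collapse regime (nested blow-up of the (M)-sieve, `Lines/wall_bubbling_M-sieve.md`) is
not touched; no facet is certified by this file; no census numeral is claimed.  Nothing here bears on (M)/(W)/(R) themselves, on `DoorA26`,
on `MatrixDescartes` (18050) or on `VP ≠ VNP`; registers unchanged.

Cell `pub-symmetroid`, seat val-sym-door-p2 g12 (W1 #10b of R2694 (B)), `--supports stmt-ValiantsHypothesis-19979 --as helper`.
[this work] Assembly of W1 #1, W3 parts 1–3 and #10a; elementary.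
-/

-- `Summit.ValiantsHypothesis.ValiantsHypothesis.…` repeats a component by the D-0017 layout
-- (single-conjunct summit), which the `dupNamespace` linter flags; the name is mandated.
set_option linter.dupNamespace false

namespace Summit.ValiantsHypothesis.ValiantsHypothesis.Theorems.LacunarySymmetroidMatrixDescartes.WallBubbling.SecondOrder

open Finset Filter Topology
open scoped BigOperators
open Summit.ValiantsHypothesis.ValiantsHypothesis.Theorems.LacunarySymmetroidMatrixDescartes.WallBubbling.Bubbling

/-! ## §1 The only coincidence at a generic facet point -/

/-- On a sequence that is monotone along `Fin 21` and strictly increasing at every adjacent step except the `t`-th, two positions with the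
same value are equal or are the two ends of the `t`-th step. [folklore] -/
theorem facet_step_eq (f : Fin 21 → ℝ) (t : Fin 20)
    (h_le : ∀ i : Fin 20, f i.castSucc ≤ f i.succ) (h_strict : ∀ i : Fin 20, i ≠ t → f i.castSucc < f i.succ)
    {u v : Fin 21} (huv : u < v) (hfe : f u = f v) : u = t.castSucc ∧ v = t.succ := by
  have hmono : Monotone f := Fin.monotone_iff_le_succ.mpr h_le
  have hu20 : (u : ℕ) < 20 := by have := v.isLt; omega
  by_cases hu : u = t.castSucc
  · refine ⟨hu, ?_⟩
    by_contra hv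
    -- then `v ≥ t + 2`, and the step `v - 1 ≠ t` is strict
    have hv2 : (t : ℕ) + 2 ≤ v := by
      have h1 : (u : ℕ) = t := by rw [hu]; rfl
      have h2 : (v : ℕ) ≠ t + 1 := fun h => hv (Fin.ext (by rw [h]; simp))
      omega
    have hv1 : 0 < (v : ℕ) := by omega
    set w : Fin 20 := ⟨(v : ℕ) - 1, by omega⟩ with hw
    have hwt : w ≠ t := by
      intro h; have := congrArg Fin.val h; simp [hw] at this; omega
    have hws : w.succ = v := Fin.ext (by simp [hw]; omega)
    have hwc : u ≤ w.castSucc := by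
      rw [Fin.le_iff_val_le_val]; simp [hw]; omega
    have := h_strict w hwt
    rw [hws] at this
    have := hmono hwc
    linarith
  · exfalso
    set w : Fin 20 := ⟨u, hu20⟩ with hw
    have hwt : w ≠ t := by
      intro h; apply hu; exact Fin.ext (by rw [← h]; simp [hw])
    have hwc : w.castSucc = u := Fin.ext rfl
    have hws : w.succ ≤ v := by
      rw [Fin.le_iff_val_le_val]; simp [hw]; omega
    have := h_strict w hwt
    rw [hwc] at this
    have := hmono hws
    linarith

/-- **The only coincidence at a generic facet point.**  Let `σ` list every pair up to swap and let `δ₀` be a generic point of the facet of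
`σ` at position `t`, the two pairs listed there being `(i,i)` and `(k,l)` (in either order, `(k,l)` up to swap).  Then every pair-sum
coincidence of `δ₀` is trivial (equal pairs up to swap) or is the one between `(i,i)` and `(k,l)` — W3's hypothesis `honly`. [this work] -/
theorem honly_of_facet (σ : Fin 21 → Fin 6 × Fin 6) (hcov : ∀ p : Fin 6 × Fin 6, ∃ u : Fin 21, σ u = p ∨ σ u = p.swap)
    (t : Fin 20) (δ₀ : Fin 6 → ℝ)
    (h_eq : δ₀ (σ t.castSucc).1 + δ₀ (σ t.castSucc).2 = δ₀ (σ t.succ).1 + δ₀ (σ t.succ).2)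
    (h_strict : ∀ u : Fin 20, u ≠ t → δ₀ (σ u.castSucc).1 + δ₀ (σ u.castSucc).2 < δ₀ (σ u.succ).1 + δ₀ (σ u.succ).2)
    (i k l : Fin 6)
    (hends : ∀ u : Fin 21, u = t.castSucc ∨ u = t.succ → σ u = (i, i) ∨ σ u = (k, l) ∨ σ u = (l, k)) :
    ∀ a b a' b' : Fin 6, δ₀ a + δ₀ b = δ₀ a' + δ₀ b' →
      ((a = a' ∧ b = b') ∨ (a = b' ∧ b = a')) ∨
      (((a = i ∧ b = i) ∨ (a = k ∧ b = l) ∨ (a = l ∧ b = k)) ∧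
       ((a' = i ∧ b' = i) ∨ (a' = k ∧ b' = l) ∨ (a' = l ∧ b' = k))) := by
  set f : Fin 21 → ℝ := fun u => δ₀ (σ u).1 + δ₀ (σ u).2 with hf
  have h_le : ∀ u : Fin 20, f u.castSucc ≤ f u.succ := by
    intro u
    by_cases hu : u = t
    · subst hu; exact le_of_eq h_eq
    · exact le_of_lt (h_strict u hu)
  -- value of `f` at the position of a pair
  have hval : ∀ (p : Fin 6 × Fin 6) (u : Fin 21), (σ u = p ∨ σ u = p.swap) → f u = δ₀ p.1 + δ₀ p.2 := by
    rintro p u (h | h)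
    · simp only [hf, h]
    · simp only [hf, h, Prod.fst_swap, Prod.snd_swap]; ring
  -- membership of a pair in the special class from its position
  have hspec : ∀ (p : Fin 6 × Fin 6) (u : Fin 21), (σ u = p ∨ σ u = p.swap) → (u = t.castSucc ∨ u = t.succ) →
      ((p.1 = i ∧ p.2 = i) ∨ (p.1 = k ∧ p.2 = l) ∨ (p.1 = l ∧ p.2 = k)) := by
    intro p u hu ht
    have hp : p = σ u ∨ p = (σ u).swap := by
      rcases hu with h | h
      · exact Or.inl h.symm
      · right; rw [h, Prod.swap_swap]
    rcases hends u ht with h | h | h <;> rw [h] at hp <;> rcases hp with rfl | rfl <;> simp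
  intro a b a' b' hsum
  obtain ⟨u, hu⟩ := hcov (a, b)
  obtain ⟨v, hv⟩ := hcov (a', b')
  have hfu : f u = δ₀ a + δ₀ b := hval (a, b) u hu
  have hfv : f v = δ₀ a' + δ₀ b' := hval (a', b') v hv
  have hfe : f u = f v := by rw [hfu, hfv, hsum]
  rcases lt_trichotomy u v with huv | huv | huv
  · obtain ⟨hu', hv'⟩ := facet_step_eq f t h_le h_strict huv hfe
    right
    exact ⟨hspec (a, b) u hu (Or.inl hu'), hspec (a', b') v hv (Or.inr hv')⟩
  · subst huv
    left
    rcases hu with h | h <;> rcases hv with h' | h'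
    · left; have := h.symm.trans h'; exact ⟨(Prod.mk.inj this).1, (Prod.mk.inj this).2⟩
    · right; have := h.symm.trans h'; simp only [Prod.swap, Prod.mk.injEq] at this; exact ⟨this.1, this.2⟩
    · right; have := h.symm.trans h'; simp only [Prod.swap, Prod.mk.injEq] at this; exact ⟨this.2, this.1⟩
    · left; have := h.symm.trans h'; simp only [Prod.swap, Prod.mk.injEq] at this; exact ⟨this.2, this.1⟩
  · obtain ⟨hv', hu'⟩ := facet_step_eq f t h_le h_strict huv hfe.symm
    right
    exact ⟨hspec (a, b) u hu (Or.inr hu'), hspec (a', b') v hv (Or.inl hv')⟩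

/-! ## §2 KILL(j) in census currency, modulo collapse -/

/-- From the chain's `Realisable` to the realisable SHAPE `ε • (v vᵀ − u uᵀ − w wᵀ)` consumed by `…WallBubblingMixedParity`. [folklore] -/
theorem shape_of_realisable {G : Matrix (Fin 6) (Fin 6) ℝ} (hG : Realisable G) :
    ∃ (ε : ℝ) (v u w : Fin 6 → ℝ), G = ε • (Matrix.vecMulVec v v - Matrix.vecMulVec u u - Matrix.vecMulVec w w) := by
  obtain ⟨ε, S, -, hS, h⟩ := hG
  obtain ⟨v, u, w, hvuw⟩ := WallBubbling.realisable_shape S hS ε G (fun a b => by rw [h a b]; rfl)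
  exact ⟨ε, v, u, w, hvuw⟩

/-- An odd exponent makes the alternation factor `−1`: `0 < (−1)^n · x` with `n` odd means `x < 0`. [folklore] -/
theorem neg_of_odd_alt {n : ℕ} (hn : Odd n) {x : ℝ} (h : 0 < (-1 : ℝ) ^ n * x) : x < 0 := by
  rw [hn.neg_one_pow] at h
  linarith

/-- **KILL(j) IN CENSUS CURRENCY (modulo collapse).**  Data: a pair order `σ`; distinct letters `i, k, l` of a mixed wall and a fourth
letter `j`; positions `t₀, a, b, c` of `σ` listing `(i,i)`, `(j,j)`, `{j,k}`, `{j,l}`; the PARITY CERTIFICATE `Odd (a + t₀)` (so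
`G_jj·G_ii < 0` in the chamber of `σ`) and `Odd (b + c)` (so `G_jk·G_jl < 0`).  Let `D` be a cluster datum whose cluster `c⋆` is
`σ`-SIGNED and REALISABLE at every stage and has the mixed block anatomy at scale `B ≠ 0` (`B⁻¹ • G^ν_II → Eᵢᵢ − ½(Eₖₗ + Eₗₖ)`,
`I = (i,k,l)`).  Then along every subsequence `φ`, for every scale `ρ_ν > 0` and every limit `ω` of the rescaled `j`-cross vectors
`(ρ ν)⁻¹ · (G^{φν}_{ij}, G^{φν}_{kj}, G^{φν}_{lj})`: `ω₀ = 0 ∧ ω₁·ω₂ = 0` — the accumulation is in the COLLAPSE REGIME for `j`.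
Proof: the signs give `hopp` and opposite cross signs (`cross_limit_nonpos`); outside collapse `q(ω) > 0`
(`q_pos_of_opposite_cross_signs`) and `mixedWall_parity_kill` applies. [this work] -/
theorem mixedWall_kill_collapse (σ : Fin 21 → Fin 6 × Fin 6) {δstar : Fin 6 → ℝ}
    (i k l j : Fin 6) (t₀ a b c : Fin 21)
    (ht₀ : σ t₀ = (i, i)) (ha : σ a = (j, j)) (hb : σ b = (j, k) ∨ σ b = (k, j)) (hc : σ c = (j, l) ∨ σ c = (l, j))
    (hpar₁ : Odd ((a : ℕ) + t₀)) (hpar₂ : Odd ((b : ℕ) + c))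
    (D : ClusterLimit δstar) (cb : Fin D.C)
    (hreal : ∀ ν, Realisable (Matrix.of fun x y => D.a cb ν (x, y)))
    (hsgn : ∀ ν (u u' : Fin 21), 0 < (-1 : ℝ) ^ ((u : ℕ) + u') * (D.a cb ν (σ u) * D.a cb ν (σ u')))
    (B : ℝ) (hB : B ≠ 0)
    (hblock : Tendsto (fun ν => B⁻¹ • (Matrix.of fun x y => D.a cb ν (x, y)).submatrix ![i, k, l] ![i, k, l]) atTop
      (𝓝 !![1, 0, 0; 0, 0, -1/2; 0, -1/2, 0]))
    (φ : ℕ → ℕ) (hφ : StrictMono φ) (ρ : ℕ → ℝ) (hρ : ∀ ν, 0 < ρ ν) (ω : Fin 3 → ℝ)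
    (hcross : Tendsto (fun ν (x : Fin 3) => (ρ ν)⁻¹ * D.a cb (φ ν) ((![i, k, l] : Fin 3 → Fin 6) x, j)) atTop (𝓝 ω)) :
    ω 0 = 0 ∧ ω 1 * ω 2 = 0 := by
  set G : ℕ → Matrix (Fin 6) (Fin 6) ℝ := fun ν => Matrix.of fun x y => D.a cb (φ ν) (x, y) with hGdef
  set I : Fin 3 → Fin 6 := ![i, k, l] with hI
  have hshape : ∀ ν, ∃ (ε : ℝ) (v u w : Fin 6 → ℝ),
      G ν = ε • (Matrix.vecMulVec v v - Matrix.vecMulVec u u - Matrix.vecMulVec w w) := fun ν => shape_of_realisable (hreal (φ ν))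
  have hsymm : ∀ ν x y, G ν x y = G ν y x := fun ν x y => (isSymm_of_realisable (hreal (φ ν))).apply y x
  have hblock' : Tendsto (fun ν => ((fun _ : ℕ => B) ν)⁻¹ • (G ν).submatrix I I) atTop
      (𝓝 !![(1 : ℝ), 0, 0; 0, 0, -1/2; 0, -1/2, 0]) := hblock.comp hφ.tendsto_atTop
  have hcross' : Tendsto (fun ν (x : Fin 3) => (ρ ν)⁻¹ * G ν (I x) j) atTop (𝓝 ω) := by
    simpa only [hGdef, hI, Matrix.of_apply] using hcross
  -- (b) the signs from the chamber
  have hopp : ∀ ν, G ν j j * G ν (I 0) (I 0) < 0 := by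
    intro ν
    have h := hsgn (φ ν) a t₀
    rw [ha, ht₀] at h
    have : I 0 = i := by simp [hI]
    rw [this]
    exact neg_of_odd_alt hpar₁ h
  have hcr : ∀ ν, G ν (I 1) j * G ν (I 2) j ≤ 0 := by
    intro ν
    have h := hsgn (φ ν) b c
    have h1 : D.a cb (φ ν) (σ b) = G ν k j := by
      rcases hb with h' | h' <;> rw [h'] <;> [exact hsymm ν j k; rfl]
    have h2 : D.a cb (φ ν) (σ c) = G ν l j := by
      rcases hc with h' | h' <;> rw [h'] <;> [exact hsymm ν j l; rfl]
    rw [h1, h2] at h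
    have hI1 : I 1 = k := by simp [hI]
    have hI2 : I 2 = l := by simp [hI]
    rw [hI1, hI2]
    exact (neg_of_odd_alt hpar₂ h).le
  have hω12 : ω 1 * ω 2 ≤ 0 := WallBubbling.cross_limit_nonpos G I j ρ hρ ω hcross' hcr
  by_contra hnot
  have hnd : ω 0 ≠ 0 ∨ ω 1 * ω 2 ≠ 0 := by
    by_cases h0 : ω 0 = 0
    · right; exact fun h => hnot ⟨h0, h⟩
    · exact Or.inl h0
  have hq := WallBubbling.q_pos_of_opposite_cross_signs ω hω12 hnd
  exact WallBubbling.mixedWall_parity_kill G hshape I j (fun _ => B) ρ (fun _ => hB) hρ hblock' ω hcross' hq hopp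

/-- **Shape of the collapse.**  A limit direction of sup-norm `1` in the collapse regime is `± e₁` or `± e₂`: the `j`-cross vector
concentrates on exactly ONE of the entries `(j,k)`, `(j,l)`. [folklore] -/
theorem collapse_shape (ω : Fin 3 → ℝ) (hnorm : ‖ω‖ = 1) (h : ω 0 = 0 ∧ ω 1 * ω 2 = 0) :
    (ω 0 = 0 ∧ ω 1 = 0 ∧ |ω 2| = 1) ∨ (ω 0 = 0 ∧ ω 2 = 0 ∧ |ω 1| = 1) := by
  obtain ⟨h0, h12⟩ := h
  have hle : ∀ x, |ω x| ≤ 1 := fun x => by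
    have := norm_le_pi_norm ω x
    rw [Real.norm_eq_abs, hnorm] at this
    exact this
  -- some coordinate attains the norm
  have hex : ∃ x, |ω x| = 1 := by
    by_contra hcon
    push Not at hcon
    have hlt : ∀ x, ‖ω x‖ < 1 := fun x => by rw [Real.norm_eq_abs]; exact lt_of_le_of_ne (hle x) (hcon x)
    have : ‖ω‖ < 1 := (pi_norm_lt_iff zero_lt_one).mpr hlt
    linarith
  obtain ⟨x, hx⟩ := hex
  rcases mul_eq_zero.mp h12 with h1 | h2
  · left
    refine ⟨h0, h1, ?_⟩
    fin_cases x
    · simp [h0] at hx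
    · simp [h1] at hx
    · exact hx
  · right
    refine ⟨h0, h2, ?_⟩
    fin_cases x
    · simp [h0] at hx
    · exact hx
    · simp [h2] at hx

/-- **Non-vacuity of the cross direction.**  If the `j`-cross vectors `(G^ν_ij, G^ν_kj, G^ν_lj)` are non-zero at every stage, some
subsequence, rescaled by its sup-norm, converges to a direction of norm `1`. [folklore: Bolzano–Weierstrass] -/
theorem exists_cross_direction (x : ℕ → Fin 3 → ℝ) (hx : ∀ ν, x ν ≠ 0) :
    ∃ φ : ℕ → ℕ, StrictMono φ ∧ ∃ ρ : ℕ → ℝ, (∀ ν, 0 < ρ ν) ∧ ∃ ω : Fin 3 → ℝ, ‖ω‖ = 1 ∧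
      Tendsto (fun ν (y : Fin 3) => (ρ ν)⁻¹ * x (φ ν) y) atTop (𝓝 ω) := by
  have hpos : ∀ ν, 0 < ‖x ν‖ := fun ν => norm_pos_iff.mpr (hx ν)
  set y : ℕ → Fin 3 → ℝ := fun ν => ‖x ν‖⁻¹ • x ν with hy
  have hynorm : ∀ ν, ‖y ν‖ = 1 := fun ν => by
    rw [hy, norm_smul, norm_inv, norm_norm, inv_mul_cancel₀ (hpos ν).ne']
  have hball : ∀ ν, y ν ∈ Metric.closedBall (0 : Fin 3 → ℝ) 1 := fun ν => by
    rw [Metric.mem_closedBall, dist_zero_right]; exact (hynorm ν).le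
  obtain ⟨ω, -, φ, hφ, hlim⟩ := tendsto_subseq_of_bounded Metric.isBounded_closedBall hball
  refine ⟨φ, hφ, fun ν => ‖x (φ ν)‖, fun ν => hpos (φ ν), ω, ?_, ?_⟩
  · have h1 : Tendsto (fun ν => ‖y (φ ν)‖) atTop (𝓝 ‖ω‖) := hlim.norm
    simp only [hynorm] at h1
    exact (tendsto_nhds_unique tendsto_const_nhds h1).symm
  · refine tendsto_pi_nhds.mpr fun z => ?_
    have := (tendsto_pi_nhds.mp hlim) z
    simpa [hy, Pi.smul_apply, smul_eq_mul] using this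

/-! ## §3 No accumulation from a KILL side outside the collapse regime -/

/-- **NO ACCUMULATION FROM A KILL SIDE OUTSIDE THE COLLAPSE REGIME** (R2694 (B)).  Let `σ` be a pair order with canonical pairs listing
every pair up to swap; `δ₀` a GENERIC point of its facet at position `t`, whose two listed pairs are `(i,i)` (at `t₀`) and `(k,l)` up to
swap (at `t₁`), `i, k, l` distinct — a MIXED wall; suppose the chamber ACROSS the facet carries the integer door-A row (`PosRootLawOn 2 6 19`
on the cone of `σ ∘ swap(t,t+1)`), and the chamber of `σ` carries the PARITY CERTIFICATE for a fourth letter `j` (positions `a, b, c` of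
`(j,j)`, `{j,k}`, `{j,l}` with `Odd (a+t₀)`, `Odd (b+c)`).  If twenties accumulate at `δ₀` at all, then there is a cluster datum `D` at `δ₀`,
`σ`-SIGNED and realisable at every stage (the accumulation comes from the cone of `σ`), with a blow-up cluster `c⋆` whose limit is the
mixed pattern at a scale `B ≠ 0` (all other limit entries zero), whose rescaled `j`-cross vectors DO have limit directions of norm `1` along
subsequences, and EVERY such limit direction (any subsequence, any positive scale) is collapsed: `ω₀ = 0 ∧ ω₁·ω₂ = 0`. [this work] -/
theorem kill_side_of_row (σ : Fin 21 → Fin 6 × Fin 6)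
    (hcan : ∀ u, (σ u).1 ≤ (σ u).2) (hcov : ∀ p : Fin 6 × Fin 6, ∃ u : Fin 21, σ u = p ∨ σ u = p.swap)
    (t : Fin 20) (i k l j : Fin 6) (hik : i ≠ k) (hil : i ≠ l) (hkl : k ≠ l)
    (t₀ t₁ a b c : Fin 21) (ht : (t₀ = t.castSucc ∧ t₁ = t.succ) ∨ (t₀ = t.succ ∧ t₁ = t.castSucc))
    (ht₀ : σ t₀ = (i, i)) (ht₁ : σ t₁ = (k, l) ∨ σ t₁ = (l, k))
    (ha : σ a = (j, j)) (hb : σ b = (j, k) ∨ σ b = (k, j)) (hc : σ c = (j, l) ∨ σ c = (l, j))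
    (hpar₁ : Odd ((a : ℕ) + t₀)) (hpar₂ : Odd ((b : ℕ) + c))
    (hrow : ∀ d : Fin 6 → ℕ,
      StrictMono ((fun p : Fin 6 × Fin 6 => d p.1 + d p.2) ∘ σ ∘ Equiv.swap t.castSucc t.succ) → PosRootLawOn 2 6 19 d)
    (δ₀ : Fin 6 → ℝ)
    (h_eq : δ₀ (σ t.castSucc).1 + δ₀ (σ t.castSucc).2 = δ₀ (σ t.succ).1 + δ₀ (σ t.succ).2)
    (h_strict : ∀ u : Fin 20, u ≠ t → δ₀ (σ u.castSucc).1 + δ₀ (σ u.castSucc).2 < δ₀ (σ u.succ).1 + δ₀ (σ u.succ).2)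
    (hclos : δ₀ ∈ closure TwentyLocus) :
    ∃ (D : ClusterLimit δ₀) (cb : Fin D.C) (B : ℝ), B ≠ 0 ∧
      (∀ c' ν, Realisable (Matrix.of fun x y => D.a c' ν (x, y))) ∧
      (∀ c' ν (u u' : Fin 21), 0 < (-1 : ℝ) ^ ((u : ℕ) + u') * (D.a c' ν (σ u) * D.a c' ν (σ u'))) ∧
      (∀ x y : Fin 6, ¬ ((x = i ∧ y = i) ∨ (x = k ∧ y = l) ∨ (x = l ∧ y = k)) → D.H cb (x, y) = 0) ∧
      Tendsto (fun ν => B⁻¹ • (Matrix.of fun x y => D.a cb ν (x, y)).submatrix ![i, k, l] ![i, k, l]) atTop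
        (𝓝 !![1, 0, 0; 0, 0, -1/2; 0, -1/2, 0]) ∧
      (∃ φ : ℕ → ℕ, StrictMono φ ∧ ∃ ρ : ℕ → ℝ, (∀ ν, 0 < ρ ν) ∧ ∃ ω : Fin 3 → ℝ, ‖ω‖ = 1 ∧
        Tendsto (fun ν (x : Fin 3) => (ρ ν)⁻¹ * D.a cb (φ ν) ((![i, k, l] : Fin 3 → Fin 6) x, j)) atTop (𝓝 ω)) ∧
      (∀ (φ : ℕ → ℕ), StrictMono φ → ∀ ρ : ℕ → ℝ, (∀ ν, 0 < ρ ν) → ∀ ω : Fin 3 → ℝ,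
        Tendsto (fun ν (x : Fin 3) => (ρ ν)⁻¹ * D.a cb (φ ν) ((![i, k, l] : Fin 3 → Fin 6) x, j)) atTop (𝓝 ω) →
        ω 0 = 0 ∧ ω 1 * ω 2 = 0) := by
  -- the two ends of the facet step
  have hends : ∀ u : Fin 21, u = t.castSucc ∨ u = t.succ → σ u = (i, i) ∨ σ u = (k, l) ∨ σ u = (l, k) := by
    intro u hu
    have : u = t₀ ∨ u = t₁ := by
      rcases ht with ⟨h0, h1⟩ | ⟨h0, h1⟩ <;> rcases hu with h | h
      · exact Or.inl (h.trans h0.symm)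
      · exact Or.inr (h.trans h1.symm)
      · exact Or.inr (h.trans h1.symm)
      · exact Or.inl (h.trans h0.symm)
    rcases this with rfl | rfl
    · exact Or.inl ht₀
    · exact Or.inr ht₁
  have hne : σ t.castSucc ≠ σ t.succ := by
    have hne' : σ t₀ ≠ σ t₁ := by
      rw [ht₀]
      rcases ht₁ with h | h <;> rw [h] <;> intro h' <;> [exact hik (Prod.mk.inj h').1; exact hil (Prod.mk.inj h').1]
    rcases ht with ⟨h0, h1⟩ | ⟨h0, h1⟩
    · rw [← h0, ← h1]; exact hne'
    · rw [← h0, ← h1]; exact hne'.symm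
  -- the wall equation `2 δ₀ i = δ₀ k + δ₀ l`
  have hwall : 2 * δ₀ i = δ₀ k + δ₀ l := by
    have h0 : δ₀ (σ t₀).1 + δ₀ (σ t₀).2 = δ₀ (σ t₁).1 + δ₀ (σ t₁).2 := by
      rcases ht with ⟨h0, h1⟩ | ⟨h0, h1⟩
      · rw [h0, h1]; exact h_eq
      · rw [h0, h1]; exact h_eq.symm
    rw [ht₀] at h0
    rcases ht₁ with h | h <;> rw [h] at h0 <;> simp only at h0 <;> linarith
  -- accumulation comes from the cone of `σ`
  have hclos1 : δ₀ ∈ closure (TwentyLocus ∩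
      {δ : Fin 6 → ℝ | StrictMono ((fun p : Fin 6 × Fin 6 => δ p.1 + δ p.2) ∘ σ)}) := by
    rcases closure_twentyLocus_facet_split σ t hcan hne δ₀ h_eq h_strict hclos with h | h
    · exact h
    · have hempty : TwentyLocus ∩ {δ : Fin 6 → ℝ |
          StrictMono ((fun p : Fin 6 × Fin 6 => δ p.1 + δ p.2) ∘ σ ∘ Equiv.swap t.castSucc t.succ)} = ∅ := by
        ext δ
        simp only [Set.mem_inter_iff, Set.mem_setOf_eq, Set.mem_empty_iff_false, iff_false, not_and]
        rintro ⟨S, hS, h20⟩ hcone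
        have := realCone_row_of_natRow (σ ∘ Equiv.swap t.castSucc t.succ) hrow δ hcone S hS
        omega
      rw [hempty, closure_empty] at h
      exact absurd h (Set.notMem_empty _)
  obtain ⟨D, hrealD, hsgnD⟩ := exists_clusterLimit_signed_of_mem_closure_cone σ hcov δ₀ hclos1
  -- the blow-up cluster
  have hcoin : ∃ i' j' k' l' : Fin 6, (i', j') ≠ (k', l') ∧ (i', j') ≠ (l', k') ∧ δ₀ i' + δ₀ j' = δ₀ k' + δ₀ l' :=
    ⟨i, i, k, l, fun h => hik (Prod.mk.inj h).1, fun h => hil (Prod.mk.inj h).1, by linarith⟩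
  obtain ⟨cb, hcs⟩ := exists_blowup_cluster D hcoin
  have hneH : (Matrix.of fun x y => D.H cb (x, y)) ≠ 0 := by
    intro hzero
    apply D.hH cb
    funext p
    have := congrFun (congrFun hzero p.1) p.2
    simpa using this
  have hBSZ : BlockSumsZero δ₀ (Matrix.of fun x y => D.H cb (x, y)) := blockSumsZero_of_classSums δ₀ (D.H cb) hcs
  have honly := honly_of_facet σ hcov t δ₀ h_eq h_strict i k l hends
  obtain ⟨B, hB, hHzero, hblock⟩ :=
    mixedWall_hblock_of_blowup δ₀ i k l hik hil hkl hwall honly D cb hneH (D.hreal cb) hBSZ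
  -- non-vacuity: the cross entry `(i,j)` is non-zero at every stage (sign law), so limit directions exist
  have hsymA : ∀ ν x y, D.a cb ν (x, y) = D.a cb ν (y, x) := fun ν x y =>
    (isSymm_of_realisable (hrealD cb ν)).apply y x
  have hx : ∀ ν, (fun y : Fin 3 => D.a cb ν ((![i, k, l] : Fin 3 → Fin 6) y, j)) ≠ 0 := by
    intro ν hzero
    have h0 := congrFun hzero 0
    simp only [Matrix.cons_val_zero, Pi.zero_apply] at h0
    obtain ⟨u, hu⟩ := hcov (i, j)
    have hsq := hsgnD cb ν u u
    have hau : D.a cb ν (σ u) = D.a cb ν (i, j) := by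
      rcases hu with h | h
      · rw [h]
      · rw [h]; exact hsymA ν j i
    rw [hau, h0, mul_zero, mul_zero] at hsq
    exact lt_irrefl 0 hsq
  obtain ⟨φ, hφ, ρ, hρ, ω, hω, hcross⟩ := exists_cross_direction _ hx
  refine ⟨D, cb, B, hB, hrealD, hsgnD, hHzero, hblock, ⟨φ, hφ, ρ, hρ, ω, hω, hcross⟩, ?_⟩
  intro φ' hφ' ρ' hρ' ω' hcross'
  exact mixedWall_kill_collapse σ i k l j t₀ a b c ht₀ ha hb hc hpar₁ hpar₂ D cb (hrealD cb) (hsgnD cb) B hB hblock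
    φ' hφ' ρ' hρ' ω' hcross'

end Summit.ValiantsHypothesis.ValiantsHypothesis.Theorems.LacunarySymmetroidMatrixDescartes.WallBubbling.SecondOrder
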